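import Literature.InformationTheory.StateDiscrimination.QuantumFisherInformationMatrixFormulas
import HarnessLib

/-!
# The RLD Fisher information of a full-rank state: `Î_F = Tr((∂ρ)²ρ⁻¹) = Tr(∂ρ R†) = Tr(RR†ρ)`, the
# inequality `I_F ≤ Î_F` (SLD ≤ RLD), faithfulness, additivity, and the semi-definite characterisations
# `Î_F = min{Tr M : M ≥ 0, [[M, ∂ρ],[∂ρ, ρ]] ≥ 0}`, `I_F = 2min{μ : [[μ, vec ∂ρ†],[vec ∂ρ, ρᵀ⊗1+1⊗ρ]] ≥ 0}` via the
# Schur complement `X†Y⁻¹X = min{M : [[M,X†],[X,Y]] ≥ 0}` (Katariya–Wilde 2021 § 5.1.3 Def. 3 / (RLD-diff-eq) /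
# `I_F ≤ Î_F`, § 5.2 Props. 5–6, § 5.4.1 Prop. 24, § 5.4.4 Prop. 28, § 9 Lemma 57)

Hodge foundations lane (`lit-hodgefound`, prover p24 gen 80; quantum-information series).  THEOREMS ONLY: no
definition, no named fact, net debt 0.  Vocabulary: a full-rank state `ρ ≻ 0` (the support condition
`supp(∂ρ) ⊆ supp(ρ)` is then automatic and the projection `Π_ρ = 1`), Hermitian derivative data `D = ∂_θρ`, the
RLD `R := ρ⁻¹∂_θρ` (the unique solution of `∂_θρ = ρR`), SLDs `S` in the Bertlmann–Friis normalisation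
`Sρ + ρS = ∂_θρ` (`L = 2S`, `I_F = Tr(L²ρ) = 2Tr(S∂_θρ)`, cf. `QuantumFisherInformationProperties.lean`), and
the RLD Fisher information as the EXPRESSION `Tr(∂_θρ ρ⁻¹ ∂_θρ) = Tr((∂_θρ)²ρ⁻¹)`.

## Source, VERBATIM

V. Katariya, M. M. Wilde, *Geometric distinguishability measures limit quantum channel estimation and
discrimination*, Quantum Inf. Process. 20 (2021) 78 [KatariyaWilde2021], held `paper:arxiv-2004.10708`.  § 5.1.3
(p0013–p0014): «**Definition 3 (RLD Fisher information)** … `Î_F(θ;{ρ_θ}) = Tr[(∂_θρ_θ)²ρ_θ⁻¹]` if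
`supp(∂_θρ_θ) ⊆ supp(ρ_θ)`, `+∞` otherwise … In the case that the following support condition holds … the RLD
Fisher information can also be defined in the following way: `Î_F(θ;{ρ_θ}) := Tr[R_θR_θ†ρ_θ] = Tr[(∂_θρ_θ)R_θ†]`,
where the RLD operator [YL73] is defined through the following differential equation: `∂_θρ_θ = ρ_θR_θ`. By
observing from (RLD-diff-eq) that `Π_{ρ_θ}R_θ = ρ_θ⁻¹∂_θρ_θ` … The SLD Fisher information never exceeds the RLD
Fisher information: `I_F(θ;{ρ_θ}) ≤ Î_F(θ;{ρ_θ})`, which can be seen from the operator convexity of the function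
`x⁻¹` …».  § 5.2.1 (p0014): «**Proposition 5 (Faithfulness)** … the SLD and RLD Fisher informations are equal
to zero … if and only if `ρ_A^θ` has no dependence on the parameter `θ`».  § 5.2.3 (p0015): «**Proposition 6**
… `Î_F(θ;{ρ_A^θ ⊗ σ_B^θ}) = Î_F(θ;{ρ_A^θ}) + Î_F(θ;{σ_B^θ})`».  § 5.4.4 (p0023): «**Proposition 28** The RLD
Fisher information of a differentiable family `{ρ_θ}` of states satisfying the support condition … can be
evaluated by means of the following semi-definite program:
`Î_F(θ;{ρ_A^θ}) = inf{Tr[M] : M ≥ 0, [[M, ∂_θρ_θ],[∂_θρ_θ, ρ_θ]] ≥ 0}`. … Proof. The primal semi-definite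
program is a direct consequence of the RLD formula in (RLD-FI) and Lemma 57.»  § 5.4.1 (p0021): «**Proposition 24**
The SLD Fisher information … can be evaluated by means of the following semi-definite program:
`I_F(θ;{ρ_θ}) = 2·inf{μ ∈ ℝ : [[μ, ⟨Γ|(∂_θρ_θ ⊗ I)],[(∂_θρ_θ ⊗ I)|Γ⟩, ρ_θ ⊗ I + I ⊗ ρ_θᵀ]] ≥ 0}`.»  § 9 (p0045): «**Lemma 57** Let
`X` be a linear operator and let `Y` be a positive definite operator. Then `X†Y⁻¹X = min{M : [[M, X†],[X, Y]] ≥ 0}`,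
where the ordering for the minimization is understood in the operator interval sense (Löwner order). Proof. This
is a direct consequence of the Schur complement lemma, which states that
`[[M, X†],[X, Y]] ≥ 0 ⟺ Y ≥ 0, M ≥ X†Y⁻¹X`.»

## Roads (no definitions introduced)

* § 1 `R = ρ⁻¹D` from `ρR = D` (`ρ` invertible); `R† = Dρ⁻¹`; the three printed expressions agree; `Dρ⁻¹D = Dρ⁻¹D†`
  is positive semidefinite, so `Î_F` is real and `≥ 0`.
* § 2 (`I_F ≤ Î_F`, an algebraic road instead of operator convexity): for a Hermitian SLD,
  **`Tr(Dρ⁻¹D) − 2Tr(SD) = Tr(Cρ⁻¹C†)` with `C := Sρ − ρS`**, and `Cρ⁻¹C† ⪰ 0`; in an eigenbasis this is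
  `Σ|S_ij|²(λ_i−λ_j)²(λ_i+λ_j)/λ_iλ_j ≥ 0`, i.e. `2/(λ_i+λ_j) ≤ ½(1/λ_i + 1/λ_j)`.  Directional matrix form via
  g80-#1 `dotProduct_qfim_mulVec`.
* § 3 (faithfulness, full rank): `2Tr(SD) = 4Tr(SρS†)` and `BAB† = 0 ⇒ B = 0` for `A ≻ 0`.
* § 4 (additivity): `(ρ⊗σ)⁻¹ = ρ⁻¹⊗σ⁻¹`, the cross terms are `Tr(D_ρ)Tr(D_σ) = 0`.
* § 5 Mathlib's Schur complement `Matrix.PosDef.fromBlocks₂₂`; Prop. 28 as an `IsLeast` statement (the infimum is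
  attained at `M = Dρ⁻¹D`).

## What is formalized (all PROVED)

* § 1 `rld_eq`, `mul_rld`, `conjTranspose_rld`, `trace_mul_rld`, `trace_deriv_mul_rld_conjTranspose`,
  `trace_rld_mul_conjTranspose_mul`, `trace_sq_mul_inv`, `deriv_mul_inv_mul_deriv_posSemidef`, `rldFisher_nonneg`,
  `rldFisher_im`.
* § 2 **`rldFisher_sub_sldFisher_eq`**, **`sldFisher_le_rldFisher`** (`I_F ≤ Î_F`), `dotProduct_qfim_mulVec_le_rld`.
* § 3 `sldFisher_eq_four_trace`, **`sldFisher_eq_zero_iff`**, **`rldFisher_eq_zero_iff`** (Prop. 5, full rank).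
* § 4 **`rldFisher_kronecker`** (Prop. 6, RLD line; the SLD line is g79/g80 `qfi_kronecker_add`/`qfim_kronecker`).
* § 5 **`fromBlocks_posSemidef_iff_sub_posSemidef`** (Schur), `fromBlocks_conjTranspose_inv_posSemidef`
  (Lemma 57: attained) / `sub_posSemidef_of_fromBlocks_posSemidef` (Lemma 57: minimal), **`rldFisher_isLeast`** (Prop. 28).
* § 6 **`half_sldFisher_isLeast`** (Prop. 24 in Liouville space: `½I_F = min{μ : [[μ, vec D†],[vec D, ρᵀ⊗1+1⊗ρ]] ⪰ 0}`),
  `sldFisher_eq_two_mul_of_isLeast`.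

NOT formalized: rank-deficient states (`+∞` branch, `Π_ρ`), Prop. 4 (limit), data processing (Prop. 6's § 5.2.2),
the cq decomposition Prop. 7 (its SLD two-block case is g80-#1 `qfim_fromBlocks_smul`), dual SDPs, channels.
Tree search (FAIL-DUP, 2026-09-01): `rg -i "RLD|right logarithmic" Literature` → two docstring mentions only.
-/

noncomputable section

open Matrix Finset
open scoped ComplexOrder ComplexConjugate Kronecker

namespace Literature.InformationTheory.StateDiscrimination.RLD

open Literature.InformationTheory.StateDiscrimination.QFIM (sld_sum_smul isHermitian_sum_smul dotProduct_qfim_mulVec)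

variable {n m ι : Type*} [Fintype n] [DecidableEq n] [Fintype m] [DecidableEq m]

/-- `ρ ≻ 0` has invertible determinant. [folklore] -/
private theorem isUnit_det_of_posDef {ρ : Matrix n n ℂ} (hρ : ρ.PosDef) : IsUnit ρ.det :=
  (isUnit_iff_isUnit_det _).mp hρ.isUnit

/-! ## § 1 The RLD and the RLD Fisher information -/

/-- **The RLD equation `∂_θρ = ρR` has the unique solution `R = ρ⁻¹∂_θρ`** for a full-rank state
(«`Π_ρR = ρ⁻¹∂_θρ`» with `Π_ρ = 1`). [cite: KatariyaWilde2021, §5.1.3 (RLD-diff-eq)] -/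
theorem rld_eq {ρ R D : Matrix n n ℂ} (hρ : ρ.PosDef) (hR : ρ * R = D) : R = ρ⁻¹ * D := by
  rw [← hR, nonsing_inv_mul_cancel_left ρ _ (isUnit_det_of_posDef hρ)]

/-- `R := ρ⁻¹D` solves `ρR = D`. [cite: KatariyaWilde2021, §5.1.3 (RLD-diff-eq)] -/
theorem mul_rld {ρ : Matrix n n ℂ} (hρ : ρ.PosDef) (D : Matrix n n ℂ) : ρ * (ρ⁻¹ * D) = D :=
  mul_nonsing_inv_cancel_left ρ _ (isUnit_det_of_posDef hρ)

/-- `R† = Dρ⁻¹` for Hermitian `D` (the RLD is not Hermitian in general). [cite: KatariyaWilde2021, §5.1.3] -/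
theorem conjTranspose_rld {ρ D : Matrix n n ℂ} (hρ : ρ.PosDef) (hD : D.IsHermitian) :
    (ρ⁻¹ * D)ᴴ = D * ρ⁻¹ := by
  rw [conjTranspose_mul, hD.eq, conjTranspose_nonsing_inv, hρ.1.eq]

/-- `Tr(ρR) = Tr(∂_θρ)` (`= 0` along a curve of states). [cite: KatariyaWilde2021, §5.1.3] -/
theorem trace_mul_rld {ρ : Matrix n n ℂ} (hρ : ρ.PosDef) (D : Matrix n n ℂ) : (ρ * (ρ⁻¹ * D)).trace = D.trace := by
  rw [mul_rld hρ]

/-- **`Tr[(∂_θρ)R†] = Tr[(∂_θρ)²ρ⁻¹]`**. [cite: KatariyaWilde2021, §5.1.3 (RLD-FI-support)] -/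
theorem trace_deriv_mul_rld_conjTranspose {ρ D : Matrix n n ℂ} (hρ : ρ.PosDef) (hD : D.IsHermitian) :
    (D * (ρ⁻¹ * D)ᴴ).trace = (D * D * ρ⁻¹).trace := by
  rw [conjTranspose_rld hρ hD, Matrix.mul_assoc]

/-- **`Tr[RR†ρ] = Tr[(∂_θρ)²ρ⁻¹]`**. [cite: KatariyaWilde2021, §5.1.3 (RLD-FI-support)] -/
theorem trace_rld_mul_conjTranspose_mul {ρ D : Matrix n n ℂ} (hρ : ρ.PosDef) (hD : D.IsHermitian) :
    (ρ⁻¹ * D * (ρ⁻¹ * D)ᴴ * ρ).trace = (D * D * ρ⁻¹).trace := by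
  rw [conjTranspose_rld hρ hD]
  calc (ρ⁻¹ * D * (D * ρ⁻¹) * ρ).trace = (ρ⁻¹ * (D * D) * (ρ⁻¹ * ρ)).trace := by simp only [Matrix.mul_assoc]
    _ = (ρ⁻¹ * (D * D)).trace := by rw [nonsing_inv_mul ρ (isUnit_det_of_posDef hρ), Matrix.mul_one]
    _ = (D * D * ρ⁻¹).trace := Matrix.trace_mul_comm _ _

omit [DecidableEq n] in
/-- `Tr[(∂_θρ)²ρ⁻¹] = Tr[∂_θρ ρ⁻¹ ∂_θρ]` (cyclicity; the form used below). [cite: KatariyaWilde2021, §5.1.3 Def. 3] -/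
theorem trace_sq_mul_inv (D P : Matrix n n ℂ) : (D * D * P).trace = (D * P * D).trace := by
  rw [Matrix.mul_assoc, Matrix.trace_mul_comm, Matrix.mul_assoc]

/-- `∂_θρ ρ⁻¹ ∂_θρ ⪰ 0` for `ρ ≻ 0` and Hermitian `∂_θρ`. [cite: KatariyaWilde2021, §5.1.3 Def. 3] -/
theorem deriv_mul_inv_mul_deriv_posSemidef {ρ D : Matrix n n ℂ} (hρ : ρ.PosDef) (hD : D.IsHermitian) :
    (D * ρ⁻¹ * D).PosSemidef := by
  have h := hρ.inv.posSemidef.mul_mul_conjTranspose_same D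
  rwa [hD.eq] at h

/-- **`Î_F ≥ 0`** (and real) for a full-rank state. [cite: KatariyaWilde2021, §5.1.3 Def. 3] -/
theorem rldFisher_nonneg {ρ D : Matrix n n ℂ} (hρ : ρ.PosDef) (hD : D.IsHermitian) :
    0 ≤ (D * ρ⁻¹ * D).trace.re :=
  (Complex.nonneg_iff.mp (deriv_mul_inv_mul_deriv_posSemidef hρ hD).trace_nonneg).1

/-- `Î_F` is real. [cite: KatariyaWilde2021, §5.1.3 Def. 3] -/
theorem rldFisher_im {ρ D : Matrix n n ℂ} (hρ : ρ.PosDef) (hD : D.IsHermitian) : (D * ρ⁻¹ * D).trace.im = 0 :=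
  (Complex.nonneg_iff.mp (deriv_mul_inv_mul_deriv_posSemidef hρ hD).trace_nonneg).2.symm

/-! ## § 2 `I_F ≤ Î_F`: the SLD Fisher information never exceeds the RLD Fisher information -/

/-- **The gap identity**: for `ρ ≻ 0`, a Hermitian `S` with `Sρ + ρS = D` and `C := Sρ − ρS`,
`Tr(Dρ⁻¹D) − 2Tr(SD) = Tr(Cρ⁻¹C†)`. [cite: KatariyaWilde2021, §5.1.3 («`I_F ≤ Î_F`»; algebraic road)] -/
theorem rldFisher_sub_sldFisher_eq {ρ S D : Matrix n n ℂ} (hρ : ρ.PosDef) (hS : S.IsHermitian)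
    (hSD : S * ρ + ρ * S = D) :
    (D * ρ⁻¹ * D).trace - 2 * (S * D).trace = ((S * ρ - ρ * S) * ρ⁻¹ * (S * ρ - ρ * S)ᴴ).trace := by
  have hu := isUnit_det_of_posDef hρ
  have c1 : ∀ Y : Matrix n n ℂ, ρ * (ρ⁻¹ * Y) = Y := fun Y => mul_nonsing_inv_cancel_left ρ Y hu
  have c2 : ∀ Y : Matrix n n ℂ, ρ⁻¹ * (ρ * Y) = Y := fun Y => nonsing_inv_mul_cancel_left ρ Y hu
  have hC : (S * ρ - ρ * S)ᴴ = ρ * S - S * ρ := by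
    rw [conjTranspose_sub, conjTranspose_mul, conjTranspose_mul, hS.eq, hρ.1.eq]
  have t1 : (S * (ρ * S)).trace = (ρ * (S * S)).trace := by
    rw [← Matrix.mul_assoc, Matrix.trace_mul_cycle, Matrix.trace_mul_comm]
  have t2 : (S * (S * ρ)).trace = (ρ * (S * S)).trace := by
    rw [← Matrix.mul_assoc, Matrix.trace_mul_comm]
  rw [hC, ← hSD]
  simp only [Matrix.add_mul, Matrix.mul_add, Matrix.sub_mul, Matrix.mul_sub, Matrix.mul_assoc, c1, c2, trace_add,
    trace_sub, t1, t2]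
  ring

/-- **`I_F ≤ Î_F` (SLD ≤ RLD)**: `2Tr(S∂_θρ) ≤ Tr(∂_θρ ρ⁻¹ ∂_θρ)` for `ρ ≻ 0` and any Hermitian SLD `S`
(`I_F = Tr(L²ρ) = 2Tr(S∂_θρ)` with `L = 2S`). [cite: KatariyaWilde2021, §5.1.3 («The SLD Fisher information never exceeds the RLD Fisher information»)] -/
theorem sldFisher_le_rldFisher {ρ S D : Matrix n n ℂ} (hρ : ρ.PosDef) (hS : S.IsHermitian)
    (hSD : S * ρ + ρ * S = D) : 2 * (S * D).trace.re ≤ (D * ρ⁻¹ * D).trace.re := by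
  have hpsd : ((S * ρ - ρ * S) * ρ⁻¹ * (S * ρ - ρ * S)ᴴ).PosSemidef :=
    hρ.inv.posSemidef.mul_mul_conjTranspose_same _
  have h0 := (Complex.nonneg_iff.mp hpsd.trace_nonneg).1
  rw [← rldFisher_sub_sldFisher_eq hρ hS hSD, Complex.sub_re] at h0
  have h2 : (2 * (S * D).trace).re = 2 * (S * D).trace.re := by simp
  linarith

/-- **Directional matrix form**: for SLDs `S_a` of `∂_aρ` and the QFIM `F_ab = 2Re Tr(S_a∂_bρ)`, every real `f` has
`fᵀFf ≤ Tr(∂_fρ ρ⁻¹ ∂_fρ)` with `∂_fρ = Σ f_a∂_aρ` (apply `I_F ≤ Î_F` to the one-parameter subfamily along `f`).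
[cite: KatariyaWilde2021, §5.1.3 («`I_F ≤ Î_F`»)] -/
theorem dotProduct_qfim_mulVec_le_rld [Fintype ι] [DecidableEq ι] {ρ : Matrix n n ℂ} (hρ : ρ.PosDef)
    {S D : ι → Matrix n n ℂ} (hS : ∀ a, (S a).IsHermitian) (hSD : ∀ a, S a * ρ + ρ * S a = D a)
    {F : Matrix ι ι ℝ} (hF : ∀ a b, F a b = 2 * (S a * D b).trace.re) (f : ι → ℝ) :
    f ⬝ᵥ (F *ᵥ f) ≤ ((∑ a, (f a : ℂ) • D a) * ρ⁻¹ * (∑ a, (f a : ℂ) • D a)).trace.re := by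
  rw [dotProduct_qfim_mulVec hF f f]
  exact sldFisher_le_rldFisher hρ (isHermitian_sum_smul f hS) (sld_sum_smul f hSD)

/-! ## § 3 Faithfulness (Prop. 5, full-rank case) -/

omit [DecidableEq n] in
/-- `BAB† = 0` with `A ≻ 0` forces `B = 0`. [folklore] -/
private theorem eq_zero_of_mul_posDef_mul_conjTranspose_eq_zero {A : Matrix n n ℂ} (hA : A.PosDef)
    {B : Matrix m n ℂ} (h : B * A * Bᴴ = 0) : B = 0 := by
  have key : ∀ x : m → ℂ, Bᴴ *ᵥ x = 0 := fun x => by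
    by_contra hx
    have hpos := hA.dotProduct_mulVec_pos hx
    have e : star (Bᴴ *ᵥ x) ⬝ᵥ (A *ᵥ (Bᴴ *ᵥ x)) = star x ⬝ᵥ ((B * A * Bᴴ) *ᵥ x) := by
      rw [star_mulVec, conjTranspose_conjTranspose, ← dotProduct_mulVec, mulVec_mulVec, mulVec_mulVec,
        Matrix.mul_assoc]
    rw [e, h, zero_mulVec, dotProduct_zero] at hpos
    exact lt_irrefl _ hpos
  have hB : Bᴴ = 0 := by
    ext i j
    have := congrFun (key (Pi.single j 1)) i
    rwa [mulVec_single_one, Pi.zero_apply] at this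
  exact conjTranspose_eq_zero.mp hB

omit [DecidableEq n] in
/-- `2Tr(S∂_θρ) = 4Tr(SρS†)` for a Hermitian SLD (`I_F = Tr(L²ρ)`). [cite: KatariyaWilde2021, §5.1.2 («`I_F = Tr[L_θ²ρ_θ]`»)] -/
theorem sldFisher_eq_four_trace {ρ S D : Matrix n n ℂ} (hS : S.IsHermitian) (hSD : S * ρ + ρ * S = D) :
    2 * (S * D).trace = 4 * (S * ρ * Sᴴ).trace := by
  rw [← hSD, Matrix.mul_add, trace_add, Matrix.trace_mul_comm S (S * ρ), ← Matrix.mul_assoc, hS.eq]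
  ring

/-- **Proposition 5 (faithfulness of `I_F`, full rank)**: for `ρ ≻ 0` and a Hermitian SLD, `I_F = 2Tr(S∂_θρ) = 0`
iff `∂_θρ = 0`. [cite: KatariyaWilde2021, §5.2.1 Prop. 5] -/
theorem sldFisher_eq_zero_iff {ρ S D : Matrix n n ℂ} (hρ : ρ.PosDef) (hS : S.IsHermitian)
    (hSD : S * ρ + ρ * S = D) : 2 * (S * D).trace.re = 0 ↔ D = 0 := by
  have e := sldFisher_eq_four_trace hS hSD
  constructor
  · intro h0
    have hpsd : (S * ρ * Sᴴ).PosSemidef := hρ.posSemidef.mul_mul_conjTranspose_same S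
    have hre : (S * ρ * Sᴴ).trace.re = 0 := by
      have h1 := congrArg Complex.re e
      simp only [Complex.mul_re, Complex.re_ofNat, Complex.im_ofNat, zero_mul, sub_zero] at h1
      linarith
    have him : (S * ρ * Sᴴ).trace.im = 0 := (Complex.nonneg_iff.mp hpsd.trace_nonneg).2.symm
    have hS0 : S = 0 :=
      eq_zero_of_mul_posDef_mul_conjTranspose_eq_zero hρ (hpsd.trace_eq_zero_iff.mp (Complex.ext hre him))
    rw [← hSD, hS0, Matrix.zero_mul, Matrix.mul_zero, add_zero]
  · rintro rfl
    simp

/-- **Proposition 5 (faithfulness of `Î_F`, full rank)**: for `ρ ≻ 0` and Hermitian `∂_θρ`,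
`Î_F = Tr(∂_θρ ρ⁻¹ ∂_θρ) = 0` iff `∂_θρ = 0`. [cite: KatariyaWilde2021, §5.2.1 Prop. 5] -/
theorem rldFisher_eq_zero_iff {ρ D : Matrix n n ℂ} (hρ : ρ.PosDef) (hD : D.IsHermitian) :
    (D * ρ⁻¹ * D).trace.re = 0 ↔ D = 0 := by
  constructor
  · intro h0
    have hpsd : (D * ρ⁻¹ * Dᴴ).PosSemidef := hρ.inv.posSemidef.mul_mul_conjTranspose_same D
    have hpsd' : (D * ρ⁻¹ * D).PosSemidef := deriv_mul_inv_mul_deriv_posSemidef hρ hD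
    have htr : (D * ρ⁻¹ * Dᴴ).trace = 0 := by
      rw [hD.eq]
      exact Complex.ext h0 (rldFisher_im hρ hD)
    exact eq_zero_of_mul_posDef_mul_conjTranspose_eq_zero hρ.inv (hpsd.trace_eq_zero_iff.mp htr)
  · rintro rfl
    simp

/-! ## § 4 Additivity (Prop. 6, RLD line) -/

/-- **Proposition 6 (additivity of the RLD Fisher information)**: for full-rank `ρ, σ` of unit trace and
trace-free derivatives, with `∂_θ(ρ⊗σ) = ∂_θρ ⊗ σ + ρ ⊗ ∂_θσ`,
`Î_F(ρ⊗σ) = Î_F(ρ) + Î_F(σ)`. [cite: KatariyaWilde2021, §5.2.3 Prop. 6] -/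
theorem rldFisher_kronecker {ρ Dρ : Matrix n n ℂ} {σ Dσ : Matrix m m ℂ} (hρ : ρ.PosDef) (hσ : σ.PosDef)
    (hρ1 : ρ.trace = 1) (hσ1 : σ.trace = 1) (hD0 : Dρ.trace = 0) :
    ((Dρ ⊗ₖ σ + ρ ⊗ₖ Dσ) * (ρ ⊗ₖ σ)⁻¹ * (Dρ ⊗ₖ σ + ρ ⊗ₖ Dσ)).trace =
      (Dρ * ρ⁻¹ * Dρ).trace + (Dσ * σ⁻¹ * Dσ).trace := by
  have huρ := isUnit_det_of_posDef hρ
  have huσ := isUnit_det_of_posDef hσ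
  rw [inv_kronecker]
  simp only [Matrix.add_mul, Matrix.mul_add, ← mul_kronecker_mul, trace_add, trace_kronecker]
  rw [mul_nonsing_inv σ huσ, mul_nonsing_inv ρ huρ, nonsing_inv_mul_cancel_right ρ Dρ huρ,
    nonsing_inv_mul_cancel_right σ Dσ huσ]
  simp only [Matrix.one_mul, hσ1, hρ1, hD0]
  ring

/-! ## § 5 The Schur complement (Lemma 57) and the semi-definite characterisation of `Î_F` (Prop. 28) -/

omit [Fintype m] [DecidableEq m] in
/-- **The Schur complement lemma**: for `Y ≻ 0`, `[[M, X†],[X, Y]] ⪰ 0 ⟺ M − X†Y⁻¹X ⪰ 0`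
(Mathlib `Matrix.PosDef.fromBlocks₂₂`). [cite: KatariyaWilde2021, §9 Lemma 57 (proof: «Schur complement lemma»)] -/
theorem fromBlocks_posSemidef_iff_sub_posSemidef [Finite m] {M : Matrix m m ℂ} {X : Matrix n m ℂ}
    {Y : Matrix n n ℂ} (hY : Y.PosDef) :
    (fromBlocks M Xᴴ X Y).PosSemidef ↔ (M - Xᴴ * Y⁻¹ * X).PosSemidef := by
  letI : Invertible Y := hY.isUnit.invertible
  have h := Matrix.PosDef.fromBlocks₂₂ M Xᴴ hY
  rwa [conjTranspose_conjTranspose] at h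

omit [Fintype m] [DecidableEq m] in
/-- **Lemma 57, attainment**: `M₀ := X†Y⁻¹X` is feasible, `[[X†Y⁻¹X, X†],[X, Y]] ⪰ 0`. [cite: KatariyaWilde2021, §9 Lemma 57] -/
theorem fromBlocks_conjTranspose_inv_posSemidef [Finite m] (X : Matrix n m ℂ) {Y : Matrix n n ℂ}
    (hY : Y.PosDef) : (fromBlocks (Xᴴ * Y⁻¹ * X) Xᴴ X Y).PosSemidef := by
  rw [fromBlocks_posSemidef_iff_sub_posSemidef hY, sub_self]
  exact PosSemidef.zero

omit [Fintype m] [DecidableEq m] in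
/-- **Lemma 57, minimality**: every feasible `M` satisfies `M ≥ X†Y⁻¹X` (Löwner), so `X†Y⁻¹X = min{M : [[M,X†],[X,Y]] ≥ 0}`.
[cite: KatariyaWilde2021, §9 Lemma 57] -/
theorem sub_posSemidef_of_fromBlocks_posSemidef [Finite m] {M : Matrix m m ℂ} {X : Matrix n m ℂ}
    {Y : Matrix n n ℂ} (hY : Y.PosDef) (h : (fromBlocks M Xᴴ X Y).PosSemidef) :
    (M - Xᴴ * Y⁻¹ * X).PosSemidef :=
  (fromBlocks_posSemidef_iff_sub_posSemidef hY).mp h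

/-- **Proposition 28 (semi-definite program for `Î_F`)**: for `ρ ≻ 0` and Hermitian `∂_θρ`,
`Î_F = Tr(∂_θρ ρ⁻¹ ∂_θρ) = min{Tr M : M ⪰ 0, [[M, ∂_θρ],[∂_θρ, ρ]] ⪰ 0}` — the infimum is attained at
`M = ∂_θρ ρ⁻¹ ∂_θρ`. [cite: KatariyaWilde2021, §5.4.4 Prop. 28] -/
theorem rldFisher_isLeast {ρ D : Matrix n n ℂ} (hρ : ρ.PosDef) (hD : D.IsHermitian) :
    IsLeast {t : ℝ | ∃ M : Matrix n n ℂ, M.PosSemidef ∧ (fromBlocks M D D ρ).PosSemidef ∧ t = M.trace.re}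
      (D * ρ⁻¹ * D).trace.re := by
  have hiff : ∀ M : Matrix n n ℂ, (fromBlocks M D D ρ).PosSemidef ↔ (M - D * ρ⁻¹ * D).PosSemidef := fun M => by
    have h := fromBlocks_posSemidef_iff_sub_posSemidef (M := M) (X := D) hρ
    rwa [hD.eq] at h
  constructor
  · refine ⟨D * ρ⁻¹ * D, deriv_mul_inv_mul_deriv_posSemidef hρ hD, ?_, rfl⟩
    rw [hiff, sub_self]
    exact PosSemidef.zero
  · rintro t ⟨M, -, hblock, rfl⟩
    have h0 := (Complex.nonneg_iff.mp ((hiff M).mp hblock).trace_nonneg).1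
    rw [trace_sub, Complex.sub_re] at h0
    linarith

/-! ## § 6 The semi-definite characterisation of `I_F` (Prop. 24, Liouville-space form) -/

/-- A `Unit × Unit` complex matrix is positive semidefinite iff its entry is `≥ 0`. [folklore] -/
private theorem posSemidef_unit_iff {N : Matrix Unit Unit ℂ} : N.PosSemidef ↔ 0 ≤ N () () := by
  constructor
  · intro h
    have h2 := (posSemidef_iff_dotProduct_mulVec.mp h).2 (fun _ => 1)
    simpa [dotProduct, mulVec] using h2
  · intro h
    have hreal : star (N () ()) = N () () := by
      rw [Complex.star_def]
      exact Complex.conj_eq_iff_im.mpr (Complex.nonneg_iff.mp h).2.symm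
    refine posSemidef_iff_dotProduct_mulVec.mpr ⟨?_, fun x => ?_⟩
    · refine Matrix.IsHermitian.ext fun i j => ?_
      obtain rfl : i = () := rfl
      obtain rfl : j = () := rfl
      exact hreal
    · have e : star x ⬝ᵥ (N *ᵥ x) = N () () * (star (x ()) * x ()) := by
        simp [dotProduct, mulVec]
        ring
      rw [e]
      exact mul_nonneg h (star_mul_self_nonneg (x ()))

omit [DecidableEq n] in
/-- `Tr(S∂_θρ)` is real for Hermitian `S` and `∂_θρ`. [folklore] -/
private theorem im_trace_mul_of_isHermitian {S D : Matrix n n ℂ} (hS : S.IsHermitian) (hD : D.IsHermitian) :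
    (S * D).trace.im = 0 := by
  have h : star (S * D).trace = (S * D).trace := by
    rw [← trace_conjTranspose, conjTranspose_mul, hS.eq, hD.eq, Matrix.trace_mul_comm]
  rw [Complex.star_def] at h
  exact Complex.conj_eq_iff_im.mp h

/-- **Proposition 24 (semi-definite program for `I_F`)**, in Mathlib's column-stacking Liouville space
(`|Γ⟩`-vectorisation `(X ⊗ I)|Γ⟩ ↔ vec X`, `ρ ⊗ I + I ⊗ ρᵀ ↔ ρᵀ ⊗ 1 + 1 ⊗ ρ`, cf. g80-#4
`QFIMFormulas.qfim_eq_two_mul_vec_inv_vec`): for `ρ ≻ 0` and Hermitian SLD data,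
`½I_F = Tr(S∂_θρ) = min{μ : [[μ, vec(∂_θρ)†],[vec(∂_θρ), ρᵀ ⊗ 1 + 1 ⊗ ρ]] ⪰ 0}`, i.e.
`I_F = 2·inf{μ : …}` with the infimum attained. [cite: KatariyaWilde2021, §5.4.1 Prop. 24] -/
theorem half_sldFisher_isLeast {ρ S D : Matrix n n ℂ} (hρ : ρ.PosDef) (hS : S.IsHermitian) (hD : D.IsHermitian)
    (hSD : S * ρ + ρ * S = D) :
    IsLeast {μ : ℝ | (fromBlocks ((μ : ℂ) • (1 : Matrix Unit Unit ℂ)) (replicateRow Unit (star (vec D)))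
      (replicateCol Unit (vec D)) (ρᵀ ⊗ₖ (1 : Matrix n n ℂ) + (1 : Matrix n n ℂ) ⊗ₖ ρ)).PosSemidef}
      (S * D).trace.re := by
  have hM : (ρᵀ ⊗ₖ (1 : Matrix n n ℂ) + (1 : Matrix n n ℂ) ⊗ₖ ρ).PosDef := QFIMFormulas.kroneckerSum_posDef hρ
  letI : Invertible (ρᵀ ⊗ₖ (1 : Matrix n n ℂ) + (1 : Matrix n n ℂ) ⊗ₖ ρ) := hM.isUnit.invertible
  -- `vec(D)† M⁻¹ vec(D) = Tr(SD)`
  have hkey : star (vec D) ⬝ᵥ ((ρᵀ ⊗ₖ (1 : Matrix n n ℂ) + (1 : Matrix n n ℂ) ⊗ₖ ρ)⁻¹ *ᵥ vec D) =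
      (S * D).trace := by
    rw [← QFIMFormulas.vec_sld_eq_inv_mulVec hρ hSD, star_vec_dotProduct_vec, hD.eq, Matrix.trace_mul_comm]
  have hreal : ((S * D).trace.re : ℂ) = (S * D).trace :=
    Complex.ext (by simp) (by simp [im_trace_mul_of_isHermitian hS hD])
  -- feasibility of `μ` is `Tr(SD) ≤ μ` (Schur complement with the `1 × 1` corner)
  have hiff : ∀ μ : ℝ, (fromBlocks ((μ : ℂ) • (1 : Matrix Unit Unit ℂ)) (replicateRow Unit (star (vec D)))
      (replicateCol Unit (vec D)) (ρᵀ ⊗ₖ (1 : Matrix n n ℂ) + (1 : Matrix n n ℂ) ⊗ₖ ρ)).PosSemidef ↔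
      (S * D).trace.re ≤ μ := fun μ => by
    have h := Matrix.PosDef.fromBlocks₂₂ ((μ : ℂ) • (1 : Matrix Unit Unit ℂ)) (replicateRow Unit (star (vec D))) hM
    rw [conjTranspose_replicateRow, star_star] at h
    rw [h, posSemidef_unit_iff, Matrix.sub_apply, Matrix.smul_apply, Matrix.one_apply_eq, smul_eq_mul, mul_one,
      Matrix.mul_assoc, ← replicateCol_mulVec, replicateRow_mul_replicateCol_apply, hkey, ← hreal,
      ← Complex.ofReal_sub, Complex.zero_le_real, sub_nonneg, Complex.ofReal_re]
  constructor
  · exact (hiff _).mpr le_rfl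
  · intro μ hμ
    exact (hiff μ).mp hμ

/-- Hence **`I_F = 2Tr(S∂_θρ) = 2·min{μ : [[μ, vec(∂_θρ)†],[vec(∂_θρ), ρᵀ⊗1 + 1⊗ρ]] ⪰ 0}`**: the SLD Fisher
information is twice the optimal value, attained at `μ = Tr(S∂_θρ)`. [cite: KatariyaWilde2021, §5.4.1 Prop. 24] -/
theorem sldFisher_eq_two_mul_of_isLeast {ρ S D : Matrix n n ℂ} (hρ : ρ.PosDef) (hS : S.IsHermitian)
    (hD : D.IsHermitian) (hSD : S * ρ + ρ * S = D) {μ₀ : ℝ}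
    (hμ₀ : IsLeast {μ : ℝ | (fromBlocks ((μ : ℂ) • (1 : Matrix Unit Unit ℂ)) (replicateRow Unit (star (vec D)))
      (replicateCol Unit (vec D)) (ρᵀ ⊗ₖ (1 : Matrix n n ℂ) + (1 : Matrix n n ℂ) ⊗ₖ ρ)).PosSemidef} μ₀) :
    2 * (S * D).trace.re = 2 * μ₀ := by
  rw [(half_sldFisher_isLeast hρ hS hD hSD).unique hμ₀]

end Literature.InformationTheory.StateDiscrimination.RLD

end
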